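import Mathlib
import Summits.Ventures.PercRepro2.Graph
import Summits.Ventures.PercRepro2.Exploration
import Summits.Ventures.PercRepro2.Harris
import Summits.Ventures.PercRepro2.GibbsPAJoint
import Summits.Ventures.PercRepro2.SepClusterJoint
import Summits.Ventures.PercRepro2.SepClusterSupport
import Summits.Ventures.PercRepro2.SepClusterHarris
import Summits.Ventures.PercRepro2.SepFamJoint
import Summits.Ventures.PercRepro2.SepFamSupport

/-!
# The separated clusters of a family of roots — the monotone classes and the conditional Harris
inequalities (blind cell PercRepro2, p3 g12, 2026-08-27; `proofs/P3-G2.md` §3 Step 1, root sets)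

The multi-root form of `SepClusterHarris`: `IncYf` = functions of the `Y`-tuple monotone
(coordinatewise) on the support, `AntiXf` = functions of the `X`-tuple antitone on the support;
conditional Harris on each side (`harris_right_fam`, `harris_left_fam`) and the exchange of the
classes by the two conditional expectations (`antiXf_condS`, `incYf_condS_transpose`).  Own work;
standard axioms.
-/

namespace Summit.Ventures.PercRepro2

namespace SepPA

open Finset Classical

section FamilyHarris

variable {V : Type*} {E : Type*} [Fintype V] [Fintype E] [DecidableEq E]
variable (ends : E → Sym2 V) (p : E → ℝ) (X Y : Finset V)

omit [Fintype V] [Fintype E] [DecidableEq E] in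
/-- Exploring away from a larger set gives a smaller tuple. -/
lemma explAway_anti {F F' : Set V} (h : F ⊆ F') (ω : Config E) :
    explAway ends Y F' ω ≤ explAway ends Y F ω :=
  fun y => clAway_anti ends h y ω

omit [Fintype V] [Fintype E] [DecidableEq E] in
/-- `explAway` is monotone in the configuration. -/
lemma explAway_mono (F : Set V) {ω ω' : Config E} (h : ω ≤ ω') :
    explAway ends Y F ω ≤ explAway ends Y F ω' :=
  fun y => clAway_mono ends F y h

/-- Functions of the `Y`-tuple monotone on the support of the `Y`-marginal. -/
def IncYf (g : (Y → Set V) → ℝ) : Prop :=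
  ∀ t t' : Y → Set V, (∑ k, Jf ends p X Y t k) ≠ 0 → (∑ k, Jf ends p X Y t' k) ≠ 0 → t ≤ t' →
    g t ≤ g t'

/-- Functions of the `X`-tuple antitone on the support of the `X`-marginal. -/
def AntiXf (F : (X → Set V) → ℝ) : Prop :=
  ∀ k k' : X → Set V, (∑ t, Jf ends p X Y t k) ≠ 0 → (∑ t, Jf ends p X Y t k') ≠ 0 → k ≤ k' →
    F k' ≤ F k

variable {X Y}

omit [Fintype V] in
/-- The family joint law is non-negative. -/
lemma Jf_nonneg (hp01 : ∀ e, 0 < p e ∧ p e < 1) (t : Y → Set V) (k : X → Set V) :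
    0 ≤ Jf ends p X Y t k :=
  div_nonneg (prob_nonneg (isProbVec_of_interior p hp01) _)
    (prob_nonneg (isProbVec_of_interior p hp01) _)

/-- The monotone observable `ω ↦ g (expl Y of G − foot k)`. -/
lemma monotone_comp_explAway (hp01 : ∀ e, 0 < p e ∧ p e < 1) (hXY : Disjoint X Y)
    {g : (Y → Set V) → ℝ} (hg : IncYf ends p X Y g) {k : X → Set V}
    (hk : (∑ t, Jf ends p X Y t k) ≠ 0) :
    Monotone (fun ω => g (explAway ends Y (foot k) ω)) := by
  intro ω ω' h
  exact hg _ _ (explAway_mem_support_right ends p hp01 hXY hk ω)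
    (explAway_mem_support_right ends p hp01 hXY hk ω') (explAway_mono ends Y (foot k) h)

/-- The antitone observable `ω ↦ F (expl X of G − foot t)`. -/
lemma antitone_comp_explAway (hp01 : ∀ e, 0 < p e ∧ p e < 1) (hXY : Disjoint X Y)
    {F : (X → Set V) → ℝ} (hF : AntiXf ends p X Y F) {t : Y → Set V}
    (ht : (∑ k, Jf ends p X Y t k) ≠ 0) :
    Antitone (fun ω => F (explAway ends X (foot t) ω)) := by
  intro ω ω' h
  exact hF _ _ (explAway_mem_support_left ends p hp01 hXY ht ω)
    (explAway_mem_support_left ends p hp01 hXY ht ω') (explAway_mono ends X (foot t) h)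

/-- **Conditional Harris on the `Y` side.** -/
theorem harris_right_fam (hp01 : ∀ e, 0 < p e ∧ p e < 1) (hXY : Disjoint X Y)
    (g₁ g₂ : (Y → Set V) → ℝ) (h₁ : IncYf ends p X Y g₁) (h₂ : IncYf ends p X Y g₂)
    (k : X → Set V) :
    (∑ t, Jf ends p X Y t k * g₁ t) * (∑ t, Jf ends p X Y t k * g₂ t) ≤
      (∑ t, Jf ends p X Y t k * (g₁ t * g₂ t)) * (∑ t, Jf ends p X Y t k) := by
  have hJ0 : ∀ t k, 0 ≤ Jf ends p X Y t k := Jf_nonneg ends p hp01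
  by_cases hQ : (∑ t, Jf ends p X Y t k) = 0
  · have hz : ∀ t, Jf ends p X Y t k = 0 := GibbsPAJoint.all_zero_of_sum_eq_zero hJ0 hQ
    simp [hz]
  · rw [← GibbsPAJoint.marg_mul_condS _ hJ0 g₁ k, ← GibbsPAJoint.marg_mul_condS _ hJ0 g₂ k,
      ← GibbsPAJoint.marg_mul_condS _ hJ0 (fun t => g₁ t * g₂ t) k]
    rw [condS_eq_expect_fam ends p hp01 hXY g₁ hQ, condS_eq_expect_fam ends p hp01 hXY g₂ hQ,
      condS_eq_expect_fam ends p hp01 hXY (fun t => g₁ t * g₂ t) hQ]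
    have hH := expect_mul_expect_le_expect_mul (isProbVec_of_interior p hp01)
      (monotone_comp_explAway ends p hp01 hXY h₁ hQ)
      (monotone_comp_explAway ends p hp01 hXY h₂ hQ)
    have hQ0 : 0 ≤ (∑ t, Jf ends p X Y t k) := Finset.sum_nonneg (fun t _ => hJ0 t k)
    have e : expect p ((fun ω => g₁ (explAway ends Y (foot k) ω)) *
        fun ω => g₂ (explAway ends Y (foot k) ω)) =
        expect p (fun ω => g₁ (explAway ends Y (foot k) ω) * g₂ (explAway ends Y (foot k) ω)) :=
      rfl
    rw [e] at hH
    calc (∑ t, Jf ends p X Y t k) * expect p (fun ω => g₁ (explAway ends Y (foot k) ω)) *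
          ((∑ t, Jf ends p X Y t k) * expect p (fun ω => g₂ (explAway ends Y (foot k) ω)))
        = ((∑ t, Jf ends p X Y t k) * (∑ t, Jf ends p X Y t k)) *
          (expect p (fun ω => g₁ (explAway ends Y (foot k) ω)) *
            expect p (fun ω => g₂ (explAway ends Y (foot k) ω))) := by ring
      _ ≤ ((∑ t, Jf ends p X Y t k) * (∑ t, Jf ends p X Y t k)) *
          expect p (fun ω => g₁ (explAway ends Y (foot k) ω) *
            g₂ (explAway ends Y (foot k) ω)) :=
          mul_le_mul_of_nonneg_left hH (mul_nonneg hQ0 hQ0)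
      _ = _ := by ring

/-- **Conditional Harris on the `X` side.** -/
theorem harris_left_fam (hp01 : ∀ e, 0 < p e ∧ p e < 1) (hXY : Disjoint X Y)
    (F₁ F₂ : (X → Set V) → ℝ) (h₁ : AntiXf ends p X Y F₁) (h₂ : AntiXf ends p X Y F₂)
    (t : Y → Set V) :
    (∑ k, Jf ends p X Y t k * F₁ k) * (∑ k, Jf ends p X Y t k * F₂ k) ≤
      (∑ k, Jf ends p X Y t k * (F₁ k * F₂ k)) * (∑ k, Jf ends p X Y t k) := by
  have hJ0 : ∀ t k, 0 ≤ Jf ends p X Y t k := Jf_nonneg ends p hp01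
  have hJ0' : ∀ k t, 0 ≤ GibbsPAJoint.transpose (Jf ends p X Y) k t := fun k t => hJ0 t k
  by_cases hq : (∑ k, Jf ends p X Y t k) = 0
  · have hz : ∀ k, Jf ends p X Y t k = 0 := GibbsPAJoint.all_zero_of_sum_eq_zero' hJ0 hq
    simp [hz]
  · have m1 := GibbsPAJoint.marg_mul_condS (GibbsPAJoint.transpose (Jf ends p X Y)) hJ0' F₁ t
    have m2 := GibbsPAJoint.marg_mul_condS (GibbsPAJoint.transpose (Jf ends p X Y)) hJ0' F₂ t
    have m12 := GibbsPAJoint.marg_mul_condS (GibbsPAJoint.transpose (Jf ends p X Y)) hJ0'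
      (fun k => F₁ k * F₂ k) t
    simp only [GibbsPAJoint.transpose] at m1 m2 m12
    rw [← m1, ← m2, ← m12]
    rw [condS_transpose_eq_expect_fam ends p hp01 hXY F₁ hq,
      condS_transpose_eq_expect_fam ends p hp01 hXY F₂ hq,
      condS_transpose_eq_expect_fam ends p hp01 hXY (fun k => F₁ k * F₂ k) hq]
    have hmono₁ : Monotone (fun ω => (-1 : ℝ) * F₁ (explAway ends X (foot t) ω)) := by
      intro ω ω' h
      have := antitone_comp_explAway ends p hp01 hXY h₁ hq h
      simp only
      linarith
    have hmono₂ : Monotone (fun ω => (-1 : ℝ) * F₂ (explAway ends X (foot t) ω)) := by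
      intro ω ω' h
      have := antitone_comp_explAway ends p hp01 hXY h₂ hq h
      simp only
      linarith
    have hH := expect_mul_expect_le_expect_mul (isProbVec_of_interior p hp01) hmono₁ hmono₂
    rw [expect_const_mul, expect_const_mul] at hH
    have e : expect p ((fun ω => (-1 : ℝ) * F₁ (explAway ends X (foot t) ω)) *
        fun ω => (-1 : ℝ) * F₂ (explAway ends X (foot t) ω)) =
        expect p (fun ω => F₁ (explAway ends X (foot t) ω) * F₂ (explAway ends X (foot t) ω)) := by
      unfold expect
      apply Finset.sum_congr rfl
      intro ω _
      simp only [Pi.mul_apply]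
      ring
    rw [e] at hH
    have hH' : expect p (fun ω => F₁ (explAway ends X (foot t) ω)) *
        expect p (fun ω => F₂ (explAway ends X (foot t) ω)) ≤
        expect p (fun ω => F₁ (explAway ends X (foot t) ω) * F₂ (explAway ends X (foot t) ω)) := by
      linarith
    have hq0 : 0 ≤ (∑ k, Jf ends p X Y t k) := Finset.sum_nonneg (fun k _ => hJ0 t k)
    calc (∑ k, Jf ends p X Y t k) * expect p (fun ω => F₁ (explAway ends X (foot t) ω)) *
          ((∑ k, Jf ends p X Y t k) * expect p (fun ω => F₂ (explAway ends X (foot t) ω)))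
        = ((∑ k, Jf ends p X Y t k) * (∑ k, Jf ends p X Y t k)) *
          (expect p (fun ω => F₁ (explAway ends X (foot t) ω)) *
            expect p (fun ω => F₂ (explAway ends X (foot t) ω))) := by ring
      _ ≤ ((∑ k, Jf ends p X Y t k) * (∑ k, Jf ends p X Y t k)) *
          expect p (fun ω => F₁ (explAway ends X (foot t) ω) *
            F₂ (explAway ends X (foot t) ω)) :=
          mul_le_mul_of_nonneg_left hH' (mul_nonneg hq0 hq0)
      _ = _ := by ring

/-- The conditional expectation of an `IncYf` function is `AntiXf`. -/
theorem antiXf_condS (hp01 : ∀ e, 0 < p e ∧ p e < 1) (hXY : Disjoint X Y)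
    {g : (Y → Set V) → ℝ} (hg : IncYf ends p X Y g) :
    AntiXf ends p X Y (GibbsPAJoint.condS (Jf ends p X Y) g) := by
  intro k k' hk hk' hkk'
  rw [condS_eq_expect_fam ends p hp01 hXY g hk, condS_eq_expect_fam ends p hp01 hXY g hk']
  apply expect_mono (isProbVec_of_interior p hp01)
  intro ω
  exact hg _ _ (explAway_mem_support_right ends p hp01 hXY hk' ω)
    (explAway_mem_support_right ends p hp01 hXY hk ω)
    (explAway_anti ends Y (foot_mono hkk') ω)

/-- The conditional expectation of an `AntiXf` function is `IncYf`. -/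
theorem incYf_condS_transpose (hp01 : ∀ e, 0 < p e ∧ p e < 1) (hXY : Disjoint X Y)
    {F : (X → Set V) → ℝ} (hF : AntiXf ends p X Y F) :
    IncYf ends p X Y (GibbsPAJoint.condS (GibbsPAJoint.transpose (Jf ends p X Y)) F) := by
  intro t t' ht ht' htt'
  rw [condS_transpose_eq_expect_fam ends p hp01 hXY F ht,
    condS_transpose_eq_expect_fam ends p hp01 hXY F ht']
  apply expect_mono (isProbVec_of_interior p hp01)
  intro ω
  exact hF _ _ (explAway_mem_support_left ends p hp01 hXY ht' ω)
    (explAway_mem_support_left ends p hp01 hXY ht ω)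
    (explAway_anti ends X (foot_mono htt') ω)

end FamilyHarris

end SepPA

end Summit.Ventures.PercRepro2
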